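import Summits.HodgeConjecture.HodgeConjecture.Theorems.R90S6GLCosetInvariants   -- ★ W7-f (ii) `relPosition_iff_mem_doubleCoset` (relative position ⟷ Cartan double coset)
import Summits.HodgeConjecture.HodgeConjecture.Theorems.R90S6TwistedPolarity      -- ★ W9-b `mapGL_qsInvolution_stdLattice` (`Θ_σ(γ)·𝒪^N = (γ·𝒪^N)^♯`; R90-C14-p03 (g2), p863313)
import HarnessLib

/-!
# R90 · S6 «Ch. 14.1–14.5 stable TF» — WAVE 9 card W9-c: TWISTED RELATIVE POSITION ⟷ TWISTED CARTAN DOUBLE COSET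
# `inv(Λ, P_δ Λ) = a ⟺ g⁻¹ · δ Θ_σ(g) ∈ GL_N(𝒪) ϖ^a GL_N(𝒪)` for `Λ = g·𝒪^N`, `P_δ Λ = δ·Λ^♯` (`Theorems/R90S6TwistedRelPosition.lean`)

Cell `hodgecm-mathlib`, crux H413 (`stmt-HodgeConjecture-24833`), route `HCCMUnconditional`; programme R90-TF, section S6 (base `R90-C14`, dealer R90-C14-plan (g2)), seat
R90-C14-p10 (g0); card **W9-c** of typ2's W9 TARGET SHEET `R90/R90-C14-typ2/g2/S6_wave9_targets.v1.lean` fcf093c820d92b07 (= v1.1 51eba5d71d8cbf67) :89–:94, DAG r5 row E1.4.3.1.2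
(«`{g K_E : g⁻¹ δ σ_U(g) ∈ K_E t_λ K_E} ↔ inv(Λ, P_δΛ) = λ`»), DEAL W9 2026-09-04T23:48:14Z l.5370.  Statement VERBATIM from the sheet (namespace `…R90.S6`, `.Wave9` dropped).
Lane `--kind proof --supports stmt-HodgeConjecture-24833` (helper; ONE public theorem; no definition, no instance, no notation, no named fact, no `sorry`).  Imports: ★ Theorems
`R90S6GLCosetInvariants` (W7-f (ii)) + ★ Theorems `R90S6TwistedPolarity` (W9-a∕b∕d∕e₁, R90-C14-p03 (g2)) + HarnessLib; no `Cruxes` import.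

THE MATHEMATICS (Kottwitz 1986 §1 p. 240; Macdonald V (2.4)–(2.6)).  For `g, δ ∈ GL_N(K)` the twisted polar of `Λ = g·𝒪^N` is `P_δ Λ = δ·Λ^♯ = δ·(Θ_σ(g)·𝒪^N) = (δ Θ_σ g)·𝒪^N`
(★ W9-b `mapGL_qsInvolution_stdLattice` read on frames through ★ `latt_one` ∕ ★ `mapGL_latt` — the private step `latt_qsInvolution_eq_dualLatt_latt` below), so «`Λ` has a frame `h` with `h·ϖ^a·𝒪^N = P_δ Λ`» is W7-f (ii)'s relative-position clause for the pair
`(g, δ Θ_σ g)`, which ★ `relPosition_iff_mem_doubleCoset` turns into `g⁻¹ (δ Θ_σ g) ∈ GL_N(𝒪) ϖ^a GL_N(𝒪)` — the set `X_E^{δθ, λ}` of the [Kt₁] count.  With ★ W7-f (ii)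
`existsUnique_antitone_relPosition` the antitone `a = inv(Λ, P_δΛ)` exists and is unique, so both sides define the same function of `gK_E`.
HONEST LABEL: a two-line rewriting over ★ W7-f and ★ W9-b; proves no printed global statement, discharges no citation; count-neutral helper until E1.4.3.3.2 consumes it.  HC_CM is
proved only modulo the 7 printed citations (2 remaining named inputs: hLiu418 = stmt-HodgeConjecture-24832, h413 = stmt-HodgeConjecture-24833) until rung 0 closes.

## References
* [Kottwitz1986BaseChangeUnits] R. Kottwitz, *Base change for unit elements of Hecke algebras*, Compositio Math. 60 (1986), §1 p. 240.
* [Macdonald1995] I. G. Macdonald, *Symmetric Functions and Hall Polynomials*, 2nd ed. (1995), Ch. V §2 (2.4)–(2.6).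
* [Rogawski1990] J. D. Rogawski, *Automorphic Representations of Unitary Groups in Three Variables*, Ann. of Math. Stud. 123 (1990), §1.9–§1.10.
-/
set_option autoImplicit false
-- the mandated namespace repeats the single-problem summit's segment (`HodgeConjecture.HodgeConjecture`)
set_option linter.dupNamespace false

noncomputable section

open scoped Valued WithZero Matrix MatrixGroups
open Literature.NumberTheory.Automorphic Literature.NumberTheory.Automorphic.HermitianLattice Literature.NumberTheory.Automorphic.UnitaryLatticeTree

namespace Summit.HodgeConjecture.HodgeConjecture.R90.S6

variable {K : Type*} [Field K] [Valued K ℤᵐ⁰] {σ : K →+* K} {N : ℕ}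

/-- **W9-b, framed: `latt (Θ_σ γ) = (latt γ)^♯`** — the coset `Θ_σ(γ)K` is the `J₀`-dual of the lattice `γ·𝒪^N` (★ W9-b `mapGL_qsInvolution_stdLattice` of R90-C14-p03 read through
★ `latt_one` ∕ ★ `mapGL_latt`). [cite: Rogawski1990, §1.9–§1.10] -/
private theorem latt_qsInvolution_eq_dualLatt_latt (hvσ : ∀ a, Valued.v (σ a) = Valued.v a) (γ : GL (Fin N) K) :
    latt ((UnitaryGroup.qsInvolution σ γ : GL (Fin N) K) : Matrix (Fin N) (Fin N) K) =
      dualLatt σ ((StdForm.antidiagonal N).over K) (latt (γ : Matrix (Fin N) (Fin N) K)) := by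
  have h := mapGL_qsInvolution_stdLattice hvσ γ
  rwa [← latt_one, ← Units.val_one, mapGL_latt, mapGL_latt, mul_one, mul_one] at h

section Cartan

variable [ValuativeRel K] [(Valued.v : Valuation K ℤᵐ⁰).Compatible]

/-- **W9-c — THE ROW'S DICTIONARY: twisted relative position ⟷ twisted Cartan double coset.**  For `g, δ ∈ GL_N(K)`, `ϖ ≠ 0` and an exponent vector `a`: «some frame `h` of
`Λ = g·𝒪^N` has `h·ϖ^a·𝒪^N = P_δ Λ = δ·Λ^♯`» ⟺ «`g⁻¹ · δ Θ_σ(g) ∈ GL_N(𝒪) ϖ^a GL_N(𝒪)`» (`σ` valuation-preserving).  Proof: `δ·(g·𝒪^N)^♯ = (δ Θ_σ g)·𝒪^N` by ★ W9-b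
(`mapGL_qsInvolution_stdLattice`, framed) and ★ `mapGL_latt`; then ★ W7-f (ii) `relPosition_iff_mem_doubleCoset hϖ0 g (δ * Θ_σ g) a`.
[cite: Kottwitz1986BaseChangeUnits, §1 p. 240] [cite: Macdonald1995, Ch. V (2.4)–(2.6)] [cite: Rogawski1990, §1.9–§1.10] -/
theorem twistedRelPosition_iff_mem_doubleCoset (hvσ : ∀ a, Valued.v (σ a) = Valued.v a) {ϖ : K} (hϖ0 : ϖ ≠ 0)
    (g δ : GL (Fin N) K) (a : Fin N → ℤ) :
    (∃ h : GL (Fin N) K, latt ((h : GL (Fin N) K) : Matrix (Fin N) (Fin N) K) = latt ((g : GL (Fin N) K) : Matrix (Fin N) (Fin N) K) ∧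
        latt (((h * zpowDiagGL hϖ0 a : GL (Fin N) K)) : Matrix (Fin N) (Fin N) K) =
          mapGL δ (dualLatt σ ((StdForm.antidiagonal N).over K) (latt ((g : GL (Fin N) K) : Matrix (Fin N) (Fin N) K)))) ↔
      ∃ k₁ ∈ glInt N K, ∃ k₂ ∈ glInt N K, k₁ * (g⁻¹ * (δ * UnitaryGroup.qsInvolution σ g)) * k₂ = zpowDiagGL hϖ0 a := by
  rw [← latt_qsInvolution_eq_dualLatt_latt hvσ g, mapGL_latt]
  exact relPosition_iff_mem_doubleCoset hϖ0 g (δ * UnitaryGroup.qsInvolution σ g) a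

end Cartan

end Summit.HodgeConjecture.HodgeConjecture.R90.S6

end
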